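/-
Copyright (c) 2026 the pub-hodgecm-mathlib formalisation cell (harness21).  Prover seat hodgecm-mathlib-LH7-p06 (g3), req620 Track A «(D-RAM) FOUR-FRAME» squad
((β₂) road (R-36), the K6 road; K6 desk LH4-p16 (g3) WORD #1 (a) + WORD #4 (i) «the ARITHMETIC CLOSER: density from tables + split counts, cross-multiplied» — ‹K6-(f′)› by
the TABLE ROAD (R2), FILE 2), 2026-09-05.
-/
import Mathlib.Tactic.Ring
import Mathlib.Tactic.LinearCombination
import HarnessLib

/-!
# Crux `H413`, line LH4 «(D-RAM) FOUR-FRAME» — (β₂) road, K6-(f′) by the table road, FILE 2: «UNIFORM DENSITY FROM THE LEVEL TABLES AND THE DIGIT-SPLIT COUNTS» — on every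
# window cell and for both frames `β·n_t(i) = 2q^{2b}·L_t(i)` (pure arithmetic over `ℤ`)

Cell `hodgecm-mathlib` (D-0151), FLOOR 0, crux item H413 = `stmt-HodgeConjecture-24833`, route of record `HCCMUnconditional`; squad F0∕P3c∕LH4 (hand LH7-p06); lane
`--supports stmt-HodgeConjecture-24833 --as helper` (count-neutral).  THEOREMS ONLY (no `def`, no instance, no notation, no `sorry`, default heartbeats); no lattice, no field.
WHY (K6 desk LH4-p16 (g3) WORD #4 (i); SIG `F0/P3c/LH7/LH7-p06/g3/SIG-K6fprime-R2.v1.LH7p06g3.txt`).  ‹K6-(f′)› («ONE populated-fibre size over every literal digit of the row»), in the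
density currency of ★ p864238 §3 ∕ LH4-p16's K6-(e) spine (`n_t(i) = k·#S_t(i)`), follows CELL BY CELL from two tables: (1) the weighted cell sizes `n_t(i)` of the live row — ★
`rowSize_diag` (`n(b,b) = q^{2b}`) and ★ `…Beta2ConesRowSizesAllD` (inner towers `(q−1)q^{i−1}q^{2b}` both frames; boundary tower `i = d−1`: HYP `(q−2)q^{i−1}q^{2b}`, ANISO
`q^{i}q^{2b}`; far towers `d ≤ i`: HYP `2(q−1)q^{i−1}q^{2b}`, ANISO `0`); (2) the digit-split counts `L_t(i) = #((Rd.filter SPHERE_i).filter CLASS_t)` in LH7-p08 (g3)'s ONE chart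
(`β := #(Rd ∩ diagonal ball)`; K6-(d′)∕(d″)): diagonal ball half∕half `2L_t(0) = β`, inner shells half∕half `2L_t(i) = (q−1)q^{i−1}β`, boundary shell `2L_H = (q−2)q^{i−1}β`,
`2L_A = q^{i}β`, far shells `L_H = (q−1)q^{i−1}β`, `L_A = 0`.  THIS FILE is the arithmetic: with those values as NAMED LETTERS (`hn…` from (1), `hL…` from (2)), every window cell
`i < W` and both frames satisfy `β·n_t(i) = (2·q^{2b})·L_t(i)` (§1, cross-multiplied — no integrality), and `n_t(i) = φ·L_t(i)` once `2·q^{2b} = φ·β` (§2: the resolution at which every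
literal digit is attained).  So the density `k = φ` (∕ the pair `(β, 2q^{2b})`) is ONE number for the row and both frames — the `hk_t` letters of the K6-(e) spine.
* §1 `crossDensity_of_tables` (HEAD, cross-multiplied); §2 `eq_mul_of_crossDensity` (cancel `β`), `density_of_tables` (divided form under `2·q^{2b} = φ·β`).
WHAT IS NOT CLAIMED: the tables themselves ((1) is ★ ∕ ★-bound FILE 1; (2) is K6-(d″), OPEN), any census law.
HONEST LABEL.  Arithmetic only; nothing printed is asserted; ‹K6-(f′)›, (d″), ‹CORE›, β₂ stay HYPOTHESES; `HC_CM` is proved only modulo the 7 printed citations (2 remaining named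
inputs: hLiu418 = `stmt-HodgeConjecture-24832`, h413 = `stmt-HodgeConjecture-24833`) until rung 0 closes.
References: [Kottwitz1986BaseChangeUnits] §1 pp. 240–241 (cell-by-cell lattice bookkeeping) · [Flicker1998UnitaryFL] Prop. 7 p. 84 (the level tables) · [Serre1979] Ch. V §3 (residue counts).
-/

set_option autoImplicit false

namespace Summit.HodgeConjecture.HodgeConjecture.Cruxes.H413.F0P3cDyRamUniformDensityFromTables

/-! ## §1 HEAD — the cross-multiplied density identity on every window cell, both frames -/

/-- **HEAD — «UNIFORM DENSITY FROM THE TABLES» (cross-multiplied).**  Integers `q` (residue cardinality), `β` (digits in the diagonal ball), `b` (the row), `d` (conductor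
exponent), a window `W`; the weighted sizes `nH nA : ℕ → ℤ` of the two frames with the ★ table values (diagonal, inner `1 ≤ i`, `i + 1 < d`, boundary `i + 1 = d`, far `d ≤ i`), and the
digit-split counts `LH LA : ℕ → ℤ` with the K6-(d″) values ⟹ `β·n_t(i) = 2q^{2b}·L_t(i)` for every `i < W` and `t ∈ {H, A}`.
[cite: Kottwitz1986BaseChangeUnits, §1 pp. 240–241] [cite: Flicker1998UnitaryFL, Prop. 7 p. 84] -/
theorem crossDensity_of_tables (q β : ℤ) (b d W : ℕ) (nH nA LH LA : ℕ → ℤ)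
    -- (1) the weighted cell sizes (★ `rowSize_diag`, ★ `…RowSizesAllD`)
    (hn0 : 0 < W → nH 0 = q ^ (2 * b) ∧ nA 0 = q ^ (2 * b))
    (hnNear : ∀ i, 1 ≤ i → i + 1 < d → i < W → nH i = (q - 1) * q ^ (i - 1) * q ^ (2 * b) ∧ nA i = (q - 1) * q ^ (i - 1) * q ^ (2 * b))
    (hnBd : ∀ i, 1 ≤ i → i + 1 = d → i < W → nH i = (q - 2) * q ^ (i - 1) * q ^ (2 * b) ∧ nA i = q ^ i * q ^ (2 * b))
    (hnFar : ∀ i, 1 ≤ i → d ≤ i → i < W → nH i = 2 * (q - 1) * q ^ (i - 1) * q ^ (2 * b) ∧ nA i = 0)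
    -- (2) the digit-split counts per shell (K6-(d″))
    (hL0 : 0 < W → 2 * LH 0 = β ∧ 2 * LA 0 = β)
    (hLNear : ∀ i, 1 ≤ i → i + 1 < d → i < W → 2 * LH i = (q - 1) * q ^ (i - 1) * β ∧ 2 * LA i = (q - 1) * q ^ (i - 1) * β)
    (hLBd : ∀ i, 1 ≤ i → i + 1 = d → i < W → 2 * LH i = (q - 2) * q ^ (i - 1) * β ∧ 2 * LA i = q ^ i * β)
    (hLFar : ∀ i, 1 ≤ i → d ≤ i → i < W → LH i = (q - 1) * q ^ (i - 1) * β ∧ LA i = 0)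
    (i : ℕ) (hi : i < W) :
    β * nH i = 2 * q ^ (2 * b) * LH i ∧ β * nA i = 2 * q ^ (2 * b) * LA i := by
  rcases Nat.eq_zero_or_pos i with rfl | hi1
  · obtain ⟨h1, h2⟩ := hn0 hi
    obtain ⟨h3, h4⟩ := hL0 hi
    exact ⟨by rw [h1]; linear_combination (-(q ^ (2 * b))) * h3, by rw [h2]; linear_combination (-(q ^ (2 * b))) * h4⟩
  · rcases Nat.lt_trichotomy (i + 1) d with hlt | heq | hgt
    · obtain ⟨h1, h2⟩ := hnNear i hi1 hlt hi
      obtain ⟨h3, h4⟩ := hLNear i hi1 hlt hi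
      exact ⟨by rw [h1]; linear_combination (-(q ^ (2 * b))) * h3, by rw [h2]; linear_combination (-(q ^ (2 * b))) * h4⟩
    · obtain ⟨h1, h2⟩ := hnBd i hi1 heq hi
      obtain ⟨h3, h4⟩ := hLBd i hi1 heq hi
      exact ⟨by rw [h1]; linear_combination (-(q ^ (2 * b))) * h3, by rw [h2]; linear_combination (-(q ^ (2 * b))) * h4⟩
    · obtain ⟨h1, h2⟩ := hnFar i hi1 (by omega) hi
      obtain ⟨h3, h4⟩ := hLFar i hi1 (by omega) hi
      exact ⟨by rw [h1, h3]; ring, by rw [h2, h4]; ring⟩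

/-! ## §2 The divided form at an attained resolution -/

/-- **CANCELLING `β`**: `β ≠ 0`, `β·n = K·L`, `K = φ·β` ⟹ `n = φ·L`. [cite: Kottwitz1986BaseChangeUnits, §1 pp. 240–241] -/
theorem eq_mul_of_crossDensity {β K φ n L : ℤ} (hβ : β ≠ 0) (h : β * n = K * L) (hK : K = φ * β) : n = φ * L := by
  have e : β * (n - φ * L) = 0 := by rw [mul_sub, h, hK]; ring
  rcases mul_eq_zero.1 e with h0 | h0
  · exact absurd h0 hβ
  · exact sub_eq_zero.1 h0

/-- **«UNIFORM DENSITY FROM THE TABLES» (divided form).**  As `crossDensity_of_tables`, plus `β ≠ 0` and `2·q^{2b} = φ·β` (the resolution at which every literal digit of the row is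
attained) ⟹ `n_t(i) = φ·L_t(i)` on every window cell for both frames — ONE density `φ` = the `hk_t` letters of the K6-(e) spine (★ p864238 §3 ∕ LH4-p16's `coreWindow_of_perCellLaws`).
[cite: Kottwitz1986BaseChangeUnits, §1 pp. 240–241] [cite: Flicker1998UnitaryFL, Prop. 7 p. 84] -/
theorem density_of_tables (q β φ : ℤ) (b d W : ℕ) (nH nA LH LA : ℕ → ℤ) (hβ : β ≠ 0) (hφ : 2 * q ^ (2 * b) = φ * β)
    (hn0 : 0 < W → nH 0 = q ^ (2 * b) ∧ nA 0 = q ^ (2 * b))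
    (hnNear : ∀ i, 1 ≤ i → i + 1 < d → i < W → nH i = (q - 1) * q ^ (i - 1) * q ^ (2 * b) ∧ nA i = (q - 1) * q ^ (i - 1) * q ^ (2 * b))
    (hnBd : ∀ i, 1 ≤ i → i + 1 = d → i < W → nH i = (q - 2) * q ^ (i - 1) * q ^ (2 * b) ∧ nA i = q ^ i * q ^ (2 * b))
    (hnFar : ∀ i, 1 ≤ i → d ≤ i → i < W → nH i = 2 * (q - 1) * q ^ (i - 1) * q ^ (2 * b) ∧ nA i = 0)
    (hL0 : 0 < W → 2 * LH 0 = β ∧ 2 * LA 0 = β)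
    (hLNear : ∀ i, 1 ≤ i → i + 1 < d → i < W → 2 * LH i = (q - 1) * q ^ (i - 1) * β ∧ 2 * LA i = (q - 1) * q ^ (i - 1) * β)
    (hLBd : ∀ i, 1 ≤ i → i + 1 = d → i < W → 2 * LH i = (q - 2) * q ^ (i - 1) * β ∧ 2 * LA i = q ^ i * β)
    (hLFar : ∀ i, 1 ≤ i → d ≤ i → i < W → LH i = (q - 1) * q ^ (i - 1) * β ∧ LA i = 0)
    (i : ℕ) (hi : i < W) :
    nH i = φ * LH i ∧ nA i = φ * LA i := by
  obtain ⟨hH, hA⟩ := crossDensity_of_tables q β b d W nH nA LH LA hn0 hnNear hnBd hnFar hL0 hLNear hLBd hLFar i hi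
  exact ⟨eq_mul_of_crossDensity hβ hH hφ, eq_mul_of_crossDensity hβ hA hφ⟩

end Summit.HodgeConjecture.HodgeConjecture.Cruxes.H413.F0P3cDyRamUniformDensityFromTables
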